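import Literature.Geometry.Symplectic.JPlanePencilMemberCap
import Literature.Geometry.Symplectic.GromovR4StdModel
import Literature.Topology.FourManifolds.GluingConstruction
import HarnessLib

/-!
# The partial end-compactification of a standard flat end, blown up at the constraint point

Topic `Literature/Geometry/Symplectic` (infrastructure for the fact
`Literature.Geometry.Symplectic.jPlanePencil_localFamily_homotopySphere`, Wendl LNM 2216 Prop. 2.53
with `m = 1`: the blow-up trick of its proof, p. 65, reducing `m = 1` to `m = 0`).

For a point `p` of a `4`-manifold `M` with a STANDARD FLAT END at `p` — complex flat coordinates
`(z, w) = pencilCoord p x` on the punctured `ε'`-chart-ball `V`, where `‖(z, w)‖ > 1/ε'` — we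
construct the smooth `4`-manifold
  `Y = (M ∖ p) ∪_ψ Ω`,  `Ω = B_ρ(0) × B_{ρ'}(b₀) ⊂ ℂ²`,  `ψ x = (1/z(x), w(x))`,
gluing the punctured manifold to a box of the coordinates `(x', w) = (1/z, w)` along
`{x ∈ V | 1/ρ < ‖z x‖, ‖w x − b₀‖ < ρ'} ≅ {(x', w) ∈ Ω | x' ≠ 0}`.  The disc
`E = {x' = 0} ⊂ Ω` is the piece of the exceptional curve of the blown-up end-compactification
near the direction `b₀`: the members `u_b` of Gromov's pencil (`z ≈ ξ`, `w → b`) close up in `Y`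
at the distinct points `(0, b)` of `E`, with self-intersection `0` (Wendl, proof of Prop. 2.53:
"blow up at the constraint points to reduce to `m = 0`").

## Main definitions and results

* `PencilEnd p`: the parameters `(ε', b₀, ρ, ρ')` with `0 < ρ ≤ ε'`, `0 < ρ'` and
  `closedBall (e p) ε' ⊆ e.target`.
* `endChartVec q = ι (flatCx⁻¹ (q.1⁻¹, q.2))`, `endPt p q = e⁻¹ (e p + endChartVec q)`: the point of
  `M` with blown-up coordinates `q = (x', w)`; `G.pencilCoord_endPt : pencilCoord (endPt q) = (x'⁻¹, w)`.
* `G.box : Opens (ℂ × ℂ)`, `G.src`, `G.tgt`, `G.glueHomeo : OpenPartialHomeomorph (punctured p) G.box`,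
  smooth in both directions (`contMDiffOn_glueHomeo`, `contMDiffOn_glueHomeo_symm`).
* `G.glueData : SmoothGlueData (𝓡 4) 𝓘(ℝ, ℂ × ℂ) (punctured p) G.box (EuclideanSpace ℝ (Fin 4))` and
  `G.Y = G.glueData.Glued`, a `C^∞` manifold modelled on `ℝ⁴` (instances from
  `GluingConstruction.lean`), Hausdorff (`G.instT2SpaceY`, closed graph) and second countable
  (`G.instSecondCountableTopologyY`) when `M` is.

## References

* C. Wendl, *Holomorphic Curves in Low Dimensions*, LNM 2216 (2018), proof of Prop. 2.53, p. 65.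
  [Wendl2018]
* M. Gromov, *Pseudo holomorphic curves in symplectic manifolds*, Invent. Math. 82 (1985), 2.4.A′.
  [Gromov1985]
* A. Kosinski, *Differential Manifolds* (1993), VI.1 (gluing). [Kosinski1993]
-/

noncomputable section

open scoped Manifold ContDiff Topology
open Set Function Metric Filter Literature.Topology.FourManifolds

namespace Literature.Geometry.Symplectic

/-! ### The blown-up end coordinates `(x', w) ↦ e⁻¹ (e p + ι (flatCx⁻¹ (1/x', w)))` -/

section EndChart

/-- The recentred chart vector of the point with blown-up end coordinates `q = (x', w)`:
`ι (flatCx⁻¹ (x'⁻¹, w))` (junk for `x' = 0`). [cite: Wendl2018, proof of Prop. 2.53 (p. 65)] -/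
def endChartVec (q : ℂ × ℂ) : EuclideanSpace ℝ (Fin 4) :=
  inversion (flatCx.symm (q.1⁻¹, q.2))

/-- Unfolding of `endChartVec`. [folklore] -/
theorem endChartVec_def (q : ℂ × ℂ) : endChartVec q = inversion (flatCx.symm (q.1⁻¹, q.2)) := rfl

/-- `‖x'‖⁻¹ ≤ ‖flatCx⁻¹ (x'⁻¹, w)‖`. [folklore] -/
theorem inv_norm_le_norm_flatCx_symm (q : ℂ × ℂ) : ‖q.1‖⁻¹ ≤ ‖flatCx.symm (q.1⁻¹, q.2)‖ := by
  have h := norm_sq_flatCx_symm q.1⁻¹ q.2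
  have h1 : ‖q.1⁻¹‖ ^ 2 ≤ ‖flatCx.symm (q.1⁻¹, q.2)‖ ^ 2 := by rw [h]; nlinarith [norm_nonneg q.2]
  rw [← norm_inv]
  exact (pow_le_pow_iff_left₀ (norm_nonneg _) (norm_nonneg _) two_ne_zero).1 h1

/-- For `x' ≠ 0` the flat vector `flatCx⁻¹ (x'⁻¹, w)` is nonzero. [folklore] -/
theorem flatCx_symm_inv_ne_zero {q : ℂ × ℂ} (hq : q.1 ≠ 0) : flatCx.symm (q.1⁻¹, q.2) ≠ 0 := by
  intro h
  have h' : (q.1⁻¹, q.2) = 0 := by simpa using congrArg flatCx h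
  exact inv_ne_zero hq (Prod.mk.inj h').1

/-- `‖endChartVec (x', w)‖ ≤ ‖x'‖` for `x' ≠ 0`. [folklore] -/
theorem norm_endChartVec_le {q : ℂ × ℂ} (hq : q.1 ≠ 0) : ‖endChartVec q‖ ≤ ‖q.1‖ := by
  rw [endChartVec, norm_inversion]
  have hpos : 0 < ‖q.1‖⁻¹ := inv_pos.2 (norm_pos_iff.2 hq)
  calc ‖flatCx.symm (q.1⁻¹, q.2)‖⁻¹ ≤ (‖q.1‖⁻¹)⁻¹ := by
        exact inv_anti₀ hpos (inv_norm_le_norm_flatCx_symm q)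
    _ = ‖q.1‖ := inv_inv _

/-- `endChartVec (x', w) ≠ 0` for `x' ≠ 0`. [folklore] -/
theorem endChartVec_ne_zero {q : ℂ × ℂ} (hq : q.1 ≠ 0) : endChartVec q ≠ 0 :=
  inversion_ne_zero (flatCx_symm_inv_ne_zero hq)

/-- `flatCx (ι (endChartVec (x', w))) = (x'⁻¹, w)`. [folklore] -/
theorem flatCx_inversion_endChartVec (q : ℂ × ℂ) :
    flatCx (inversion (endChartVec q)) = (q.1⁻¹, q.2) := by
  rw [endChartVec, inversion_inversion, ContinuousLinearEquiv.apply_symm_apply]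

/-- `endChartVec` is `C^∞` at every `q` with `x' ≠ 0`. [folklore] -/
theorem contDiffAt_endChartVec {q : ℂ × ℂ} (hq : q.1 ≠ 0) : ContDiffAt ℝ ∞ endChartVec q := by
  have h1 : ContDiffAt ℝ ∞ (fun q : ℂ × ℂ => (q.1⁻¹, q.2)) q :=
    ((contDiffAt_fst.inv hq).prodMk contDiffAt_snd)
  have h2 : ContDiffAt ℝ ∞ (fun q : ℂ × ℂ => flatCx.symm (q.1⁻¹, q.2)) q :=
    flatCx.symm.contDiff.contDiffAt.comp q h1
  exact (contDiffAt_inversion (flatCx_symm_inv_ne_zero hq)).comp q h2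

end EndChart

/-! ### The parameters of the end gluing -/

variable {M : Type*} [TopologicalSpace M] [T2Space M] [ChartedSpace (EuclideanSpace ℝ (Fin 4)) M]

/-- The point of `M` with blown-up end coordinates `q = (x', w)`: `e⁻¹ (e p + endChartVec q)`.
[cite: Wendl2018, proof of Prop. 2.53 (p. 65)] -/
def endPt (p : M) (q : ℂ × ℂ) : M :=
  (extChartAt (𝓡 4) p).symm (extChartAt (𝓡 4) p p + endChartVec q)

omit [T2Space M] in
/-- Unfolding of `endPt`. [folklore] -/
theorem endPt_def (p : M) (q : ℂ × ℂ) :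
    endPt p q = (extChartAt (𝓡 4) p).symm (extChartAt (𝓡 4) p p + endChartVec q) := rfl

/-- **Parameters of the blown-up end gluing at `p`**: the radius `rad = ε'` of a punctured chart
ball on which the end is standard, with `closedBall (e p) ε' ⊆ e.target`; the centre `b₀` and the
radii `0 < ρ ≤ ε'`, `0 < ρ'` of the box `Ω = B_ρ(0) × B_{ρ'}(b₀)` of blown-up coordinates
`(x', w) = (1/z, w)`. [cite: Wendl2018, proof of Prop. 2.53 (p. 65)] -/
structure PencilEnd (p : M) where
  /-- the radius `ε'` of the standard punctured chart ball -/
  rad : ℝ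
  /-- the centre of the `w`-disc (the intercept of the member) -/
  b₀ : ℂ
  /-- the radius of the `x'`-disc -/
  ρ : ℝ
  /-- the radius of the `w`-disc -/
  ρ' : ℝ
  rad_pos : 0 < rad
  ρ_pos : 0 < ρ
  ρ_le : ρ ≤ rad
  ρ'_pos : 0 < ρ'
  closedBall_subset : closedBall (extChartAt (𝓡 4) p p) rad ⊆ (extChartAt (𝓡 4) p).target

namespace PencilEnd

variable {p : M} (G : PencilEnd p)

omit [T2Space M] in
/-- For `0 < ‖x'‖ < ρ` the chart vector lands in the chart target. [folklore] -/
theorem add_endChartVec_mem_target {q : ℂ × ℂ} (hq : q.1 ≠ 0) (hqρ : ‖q.1‖ < G.ρ) :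
    extChartAt (𝓡 4) p p + endChartVec q ∈ (extChartAt (𝓡 4) p).target := by
  refine G.closedBall_subset (mem_closedBall.2 ?_)
  rw [dist_eq_norm, add_sub_cancel_left]
  exact ((norm_endChartVec_le hq).trans hqρ.le).trans G.ρ_le

omit [T2Space M] in
/-- `e (endPt q) = e p + endChartVec q`. [folklore] -/
theorem extChartAt_endPt {q : ℂ × ℂ} (hq : q.1 ≠ 0) (hqρ : ‖q.1‖ < G.ρ) :
    extChartAt (𝓡 4) p (endPt p q) = extChartAt (𝓡 4) p p + endChartVec q :=
  (extChartAt (𝓡 4) p).right_inv (G.add_endChartVec_mem_target hq hqρ)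

omit [T2Space M] in
/-- `endPt q` lies in the chart source at `p`. [folklore] -/
theorem endPt_mem_source {q : ℂ × ℂ} (hq : q.1 ≠ 0) (hqρ : ‖q.1‖ < G.ρ) :
    endPt p q ∈ (chartAt (EuclideanSpace ℝ (Fin 4)) p).source := by
  rw [← extChartAt_source (𝓡 4)]
  exact (extChartAt (𝓡 4) p).map_target (G.add_endChartVec_mem_target hq hqρ)

omit [T2Space M] in
/-- `endPt q ≠ p` for `x' ≠ 0`. [folklore] -/
theorem endPt_ne {q : ℂ × ℂ} (hq : q.1 ≠ 0) (hqρ : ‖q.1‖ < G.ρ) : endPt p q ≠ p := by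
  intro h
  have h' := G.extChartAt_endPt hq hqρ
  rw [h, left_eq_add] at h'
  exact endChartVec_ne_zero hq h'

/-- `endPt q` as a point of the punctured manifold. [folklore] -/
def endPt' {q : ℂ × ℂ} (hq : q.1 ≠ 0) (hqρ : ‖q.1‖ < G.ρ) : punctured p :=
  ⟨endPt p q, mem_punctured.2 (G.endPt_ne hq hqρ)⟩

/-- Coercion of `endPt'`. [folklore] -/
@[simp] theorem coe_endPt' {q : ℂ × ℂ} (hq : q.1 ≠ 0) (hqρ : ‖q.1‖ < G.ρ) :
    ((G.endPt' hq hqρ : punctured p) : M) = endPt p q := rfl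

/-- `endPt q` lies in the punctured `ε'`-chart-ball. [folklore] -/
theorem inPuncturedChartBall_endPt' {q : ℂ × ℂ} (hq : q.1 ≠ 0) (hqρ : ‖q.1‖ < G.ρ) :
    InPuncturedChartBall p G.rad (G.endPt' hq hqρ) := by
  refine ⟨G.endPt_mem_source hq hqρ, ?_⟩
  rw [mem_ball, coe_endPt', G.extChartAt_endPt hq hqρ, dist_eq_norm, add_sub_cancel_left]
  exact lt_of_le_of_lt (norm_endChartVec_le hq) (hqρ.trans_le G.ρ_le)

/-- **The flat coordinates of `endPt (x', w)` are `(x'⁻¹, w)`.**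
[cite: Wendl2018, proof of Prop. 2.53 (p. 65)] -/
theorem pencilCoord_endPt' {q : ℂ × ℂ} (hq : q.1 ≠ 0) (hqρ : ‖q.1‖ < G.ρ) :
    pencilCoord p (G.endPt' hq hqρ) = (q.1⁻¹, q.2) := by
  rw [pencilCoord_eq_flatCx, coe_endPt', G.extChartAt_endPt hq hqρ, add_sub_cancel_left,
    flatCx_inversion_endChartVec]

omit [T2Space M] in
/-- `endPt` is `C^∞` (as a map `ℂ × ℂ → M`) at every `q` with `0 < ‖x'‖ < ρ`. [folklore] -/
theorem contMDiffAt_endPt [IsManifold (𝓡 4) ∞ M] {q : ℂ × ℂ} (hq : q.1 ≠ 0) (hqρ : ‖q.1‖ < G.ρ) :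
    ContMDiffAt 𝓘(ℝ, ℂ × ℂ) (𝓡 4) ∞ (endPt p) q := by
  have h1 : ContMDiffAt 𝓘(ℝ, ℂ × ℂ) 𝓘(ℝ, EuclideanSpace ℝ (Fin 4)) ∞
      (fun q : ℂ × ℂ => extChartAt (𝓡 4) p p + endChartVec q) q :=
    (contDiffAt_const.add (contDiffAt_endChartVec hq)).contMDiffAt
  have h2 := contMDiffOn_extChartAt_symm (I := 𝓡 4) (n := ∞) p
  exact (h2.contMDiffAt ((isOpen_extChartAt_target p).mem_nhds
    (G.add_endChartVec_mem_target hq hqρ))).comp q h1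

omit [T2Space M] in
/-- `endPt` is continuous at every `q` with `0 < ‖x'‖ < ρ`. [folklore] -/
theorem continuousAt_endPt {q : ℂ × ℂ} (hq : q.1 ≠ 0) (hqρ : ‖q.1‖ < G.ρ) :
    ContinuousAt (endPt p) q := by
  have h1 : ContinuousAt (fun q : ℂ × ℂ => extChartAt (𝓡 4) p p + endChartVec q) q := by
    refine continuousAt_const.add ?_
    have := (contDiffAt_endChartVec hq).continuousAt
    exact this
  exact ContinuousAt.comp_of_eq ((continuousOn_extChartAt_symm p).continuousAt
    ((isOpen_extChartAt_target p).mem_nhds (G.add_endChartVec_mem_target hq hqρ))) h1 rfl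

/-! ### Smoothness of the flat coordinates on the punctured chart ball -/

/-- **The flat coordinates are `C^∞` on the punctured chart ball.** [folklore] -/
theorem contMDiffOn_pencilCoord [IsManifold (𝓡 4) ∞ M] (p : M) (ε : ℝ) :
    ContMDiffOn (𝓡 4) 𝓘(ℝ, ℂ × ℂ) ∞ (pencilCoord p) {x : punctured p | InPuncturedChartBall p ε x} := by
  intro x hx
  have hE : ContMDiffAt (𝓡 4) 𝓘(ℝ, EuclideanSpace ℝ (Fin 4)) ∞
      (fun z : punctured p => extChartAt (𝓡 4) p z.1) x :=
    (contMDiffAt_extChartAt' (I := 𝓡 4) (n := ∞) hx.1).comp x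
      (contMDiff_subtype_val (I := 𝓡 4) (n := ∞) (U := punctured p) x)
  have hsub : ContMDiffAt (𝓡 4) 𝓘(ℝ, EuclideanSpace ℝ (Fin 4)) ∞
      (fun z : punctured p => extChartAt (𝓡 4) p z.1 - extChartAt (𝓡 4) p p) x :=
    hE.sub contMDiffAt_const
  have hι : ContMDiffAt 𝓘(ℝ, EuclideanSpace ℝ (Fin 4)) 𝓘(ℝ, EuclideanSpace ℝ (Fin 4)) ∞ inversion
      (extChartAt (𝓡 4) p x.1 - extChartAt (𝓡 4) p p) :=
    (contDiffAt_inversion (extChartAt_sub_ne_zero x hx.1)).contMDiffAt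
  have hfl : ContMDiff 𝓘(ℝ, EuclideanSpace ℝ (Fin 4)) 𝓘(ℝ, ℂ × ℂ) ∞
      (flatCx : EuclideanSpace ℝ (Fin 4) → ℂ × ℂ) := flatCx.contDiff.contMDiff
  have h1 := hι.comp x hsub
  have h2 := (hfl _).comp x h1
  have heq : (pencilCoord p : punctured p → ℂ × ℂ) =
      (flatCx : EuclideanSpace ℝ (Fin 4) → ℂ × ℂ) ∘ (inversion ∘
        fun z : punctured p => extChartAt (𝓡 4) p z.1 - extChartAt (𝓡 4) p p) :=
    funext fun z => pencilCoord_eq_flatCx p z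
  rw [heq]
  exact h2.contMDiffWithinAt

/-- The flat coordinates are continuous on the punctured chart ball. [folklore] -/
theorem continuousOn_pencilCoord [IsManifold (𝓡 4) ∞ M] (p : M) (ε : ℝ) :
    ContinuousOn (pencilCoord p) {x : punctured p | InPuncturedChartBall p ε x} :=
  (contMDiffOn_pencilCoord p ε).continuousOn

/-! ### The box, the gluing region and the gluing maps -/

/-- The box `Ω = B_ρ(0) × B_{ρ'}(b₀)` of blown-up coordinates, an open subset of `ℂ²`.
[cite: Wendl2018, proof of Prop. 2.53 (p. 65)] -/
def box : TopologicalSpace.Opens (ℂ × ℂ) :=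
  ⟨ball (0 : ℂ) G.ρ ×ˢ ball G.b₀ G.ρ', isOpen_ball.prod isOpen_ball⟩

omit [T2Space M] in
/-- Membership in the box. [folklore] -/
theorem mem_box_iff {q : ℂ × ℂ} : q ∈ G.box ↔ ‖q.1‖ < G.ρ ∧ ‖q.2 - G.b₀‖ < G.ρ' := by
  change q ∈ ball (0 : ℂ) G.ρ ×ˢ ball G.b₀ G.ρ' ↔ _
  rw [mem_prod, mem_ball, dist_zero_right, mem_ball, dist_eq_norm]

omit [T2Space M] in
/-- The first coordinate of a box point has norm `< ρ`. [folklore] -/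
theorem norm_fst_lt (q : G.box) : ‖(q : ℂ × ℂ).1‖ < G.ρ := (G.mem_box_iff.1 q.2).1

omit [T2Space M] in
/-- The second coordinate of a box point is within `ρ'` of `b₀`. [folklore] -/
theorem norm_snd_sub_lt (q : G.box) : ‖(q : ℂ × ℂ).2 - G.b₀‖ < G.ρ' := (G.mem_box_iff.1 q.2).2

omit [T2Space M] in
/-- The centre `(0, b₀)` of the box. [folklore] -/
theorem zero_mem_box : ((0 : ℂ), G.b₀) ∈ G.box := by
  rw [mem_box_iff]; simp [G.ρ_pos, G.ρ'_pos]

omit [T2Space M] in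
/-- The auxiliary box point `(ρ/2, b₀)` (used as a junk value). [folklore] -/
theorem half_mem_box : (((G.ρ / 2 : ℝ) : ℂ), G.b₀) ∈ G.box := by
  rw [mem_box_iff]
  refine ⟨?_, by simp [G.ρ'_pos]⟩
  rw [Complex.norm_real, Real.norm_eq_abs, abs_of_pos (half_pos G.ρ_pos)]
  exact half_lt_self G.ρ_pos

omit [T2Space M] in
/-- `ρ/2 ≠ 0` as a complex number. [folklore] -/
theorem half_ne_zero : ((G.ρ / 2 : ℝ) : ℂ) ≠ 0 := by
  exact_mod_cast (half_pos G.ρ_pos).ne'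

/-- The gluing region in `M ∖ p`: points of the punctured `ε'`-chart-ball with `1/ρ < ‖z‖` and
`‖w − b₀‖ < ρ'`. [cite: Wendl2018, proof of Prop. 2.53 (p. 65)] -/
def src : Set (punctured p) :=
  {x | InPuncturedChartBall p G.rad x ∧ G.ρ⁻¹ < ‖(pencilCoord p x).1‖ ∧
    ‖(pencilCoord p x).2 - G.b₀‖ < G.ρ'}

/-- Membership in the gluing region. [folklore] -/
theorem mem_src_iff {x : punctured p} : x ∈ G.src ↔ InPuncturedChartBall p G.rad x ∧
    G.ρ⁻¹ < ‖(pencilCoord p x).1‖ ∧ ‖(pencilCoord p x).2 - G.b₀‖ < G.ρ' := Iff.rfl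

/-- On the gluing region `z ≠ 0`. [folklore] -/
theorem fst_ne_zero_of_mem_src {x : punctured p} (hx : x ∈ G.src) : (pencilCoord p x).1 ≠ 0 :=
  norm_pos_iff.1 ((inv_pos.2 G.ρ_pos).trans hx.2.1)

/-- On the gluing region `‖z⁻¹‖ < ρ`. [folklore] -/
theorem norm_inv_fst_lt_of_mem_src {x : punctured p} (hx : x ∈ G.src) :
    ‖((pencilCoord p x).1)⁻¹‖ < G.ρ := by
  rw [norm_inv]
  have := hx.2.1
  rwa [inv_lt_comm₀ (norm_pos_iff.2 (G.fst_ne_zero_of_mem_src hx)) G.ρ_pos]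

/-- The blown-up coordinates of a point of the gluing region lie in the box. [folklore] -/
theorem glue_mem_box {x : punctured p} (hx : x ∈ G.src) :
    ((((pencilCoord p x).1)⁻¹, (pencilCoord p x).2) : ℂ × ℂ) ∈ G.box :=
  G.mem_box_iff.2 ⟨G.norm_inv_fst_lt_of_mem_src hx, hx.2.2⟩

/-- The gluing target in the box: `x' ≠ 0`. [cite: Wendl2018, proof of Prop. 2.53 (p. 65)] -/
def tgt : Set G.box :=
  {q | (q : ℂ × ℂ).1 ≠ 0}

omit [T2Space M] in
/-- Membership in the gluing target. [folklore] -/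
theorem mem_tgt_iff {q : G.box} : q ∈ G.tgt ↔ (q : ℂ × ℂ).1 ≠ 0 := Iff.rfl

open Classical in
/-- The gluing map `x ↦ (1/z(x), w(x))` (junk `(0, b₀)` off the gluing region).
[cite: Wendl2018, proof of Prop. 2.53 (p. 65)] -/
def glueFun (x : punctured p) : G.box :=
  if hx : x ∈ G.src then ⟨(((pencilCoord p x).1)⁻¹, (pencilCoord p x).2), G.glue_mem_box hx⟩
  else ⟨((0 : ℂ), G.b₀), G.zero_mem_box⟩

/-- The gluing map on the gluing region. [folklore] -/
theorem glueFun_of_mem {x : punctured p} (hx : x ∈ G.src) :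
    (G.glueFun x : ℂ × ℂ) = (((pencilCoord p x).1)⁻¹, (pencilCoord p x).2) := by
  simp [glueFun, hx]

open Classical in
/-- The inverse gluing map `(x', w) ↦ endPt (x', w)` (junk off `x' ≠ 0`).
[cite: Wendl2018, proof of Prop. 2.53 (p. 65)] -/
def glueInv (q : G.box) : punctured p :=
  if hq : (q : ℂ × ℂ).1 ≠ 0 then G.endPt' hq (G.norm_fst_lt q)
  else G.endPt' (q := (((G.ρ / 2 : ℝ) : ℂ), G.b₀)) G.half_ne_zero
    (by rw [Complex.norm_real, Real.norm_eq_abs, abs_of_pos (half_pos G.ρ_pos)]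
        exact half_lt_self G.ρ_pos)

/-- The inverse gluing map on the target. [folklore] -/
theorem coe_glueInv_of_mem {q : G.box} (hq : q ∈ G.tgt) :
    ((G.glueInv q : punctured p) : M) = endPt p q := by
  simp [glueInv, G.mem_tgt_iff.1 hq]

/-- The inverse gluing map lands in the gluing region. [folklore] -/
theorem glueInv_mem_src {q : G.box} (hq : q ∈ G.tgt) : G.glueInv q ∈ G.src := by
  have hq' : (q : ℂ × ℂ).1 ≠ 0 := hq
  have h1 : G.glueInv q = G.endPt' hq' (G.norm_fst_lt q) := by simp [glueInv, hq']
  rw [h1, mem_src_iff, G.pencilCoord_endPt' hq' (G.norm_fst_lt q)]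
  refine ⟨G.inPuncturedChartBall_endPt' hq' _, ?_, G.norm_snd_sub_lt q⟩
  rw [norm_inv]
  exact (inv_lt_inv₀ G.ρ_pos (norm_pos_iff.2 hq')).2 (G.norm_fst_lt q)

/-- The gluing map lands in the target. [folklore] -/
theorem glueFun_mem_tgt {x : punctured p} (hx : x ∈ G.src) : G.glueFun x ∈ G.tgt := by
  rw [mem_tgt_iff, G.glueFun_of_mem hx]
  exact inv_ne_zero (G.fst_ne_zero_of_mem_src hx)

/-- Left inverse: `glueInv (glueFun x) = x` on the gluing region. [folklore] -/
theorem glueInv_glueFun {x : punctured p} (hx : x ∈ G.src) : G.glueInv (G.glueFun x) = x := by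
  apply Subtype.ext
  have h1 : ((G.glueInv (G.glueFun x) : punctured p) : M) = endPt p (G.glueFun x) :=
    G.coe_glueInv_of_mem (G.glueFun_mem_tgt hx)
  rw [h1, endPt_def, endChartVec_def, G.glueFun_of_mem hx]
  simp only [inv_inv, Prod.mk.eta]
  rw [← extChartAt_sub_eq_inversion_pencilCoord, add_sub_cancel]
  exact (extChartAt (𝓡 4) p).left_inv (by rw [extChartAt_source]; exact hx.1.1)

/-- Right inverse: `glueFun (glueInv q) = q` on the target. [folklore] -/
theorem glueFun_glueInv {q : G.box} (hq : q ∈ G.tgt) : G.glueFun (G.glueInv q) = q := by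
  have hq' : (q : ℂ × ℂ).1 ≠ 0 := hq
  apply Subtype.ext
  rw [G.glueFun_of_mem (G.glueInv_mem_src hq)]
  have h1 : G.glueInv q = G.endPt' hq' (G.norm_fst_lt q) := by simp [glueInv, hq']
  rw [h1, G.pencilCoord_endPt' hq' (G.norm_fst_lt q)]
  simp

/-- The gluing region is open. [folklore] -/
theorem isOpen_src [IsManifold (𝓡 4) ∞ M] : IsOpen G.src := by
  have h := (continuousOn_pencilCoord p G.rad).isOpen_inter_preimage
    (isOpen_setOf_inPuncturedChartBall p G.rad)
    ((isOpen_lt continuous_const (continuous_fst.norm)).inter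
      (isOpen_lt ((continuous_snd.sub continuous_const).norm) continuous_const) :
      IsOpen {q : ℂ × ℂ | G.ρ⁻¹ < ‖q.1‖ ∧ ‖q.2 - G.b₀‖ < G.ρ'})
  convert h using 1
  ext x
  simp only [mem_src_iff, mem_inter_iff, mem_setOf_eq, mem_preimage]
  tauto

omit [T2Space M] in
/-- The gluing target is open. [folklore] -/
theorem isOpen_tgt : IsOpen G.tgt :=
  isOpen_ne_fun (continuous_fst.comp continuous_subtype_val) continuous_const

/-- The gluing map is `C^∞` on the gluing region. [folklore] -/
theorem contMDiffOn_glueFun [IsManifold (𝓡 4) ∞ M] :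
    ContMDiffOn (𝓡 4) 𝓘(ℝ, ℂ × ℂ) ∞ G.glueFun G.src := by
  intro x hx
  rw [← ContMDiffWithinAt.subtypeVal_comp_iff]
  have hpc : ContMDiffWithinAt (𝓡 4) 𝓘(ℝ, ℂ × ℂ) ∞ (pencilCoord p) G.src x :=
    ((contMDiffOn_pencilCoord p G.rad) x hx.1).mono fun y hy => hy.1
  have hg : ContMDiffAt 𝓘(ℝ, ℂ × ℂ) 𝓘(ℝ, ℂ × ℂ) ∞ (fun q : ℂ × ℂ => (q.1⁻¹, q.2))
      (pencilCoord p x) :=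
    ((contDiffAt_fst.inv (G.fst_ne_zero_of_mem_src hx)).prodMk contDiffAt_snd).contMDiffAt
  refine (hg.comp_contMDiffWithinAt x hpc).congr (fun y hy => ?_) ?_
  · exact G.glueFun_of_mem hy
  · exact G.glueFun_of_mem hx

/-- The inverse gluing map is `C^∞` on the target. [folklore] -/
theorem contMDiffOn_glueInv [IsManifold (𝓡 4) ∞ M] :
    ContMDiffOn 𝓘(ℝ, ℂ × ℂ) (𝓡 4) ∞ G.glueInv G.tgt := by
  intro q hq
  rw [← ContMDiffWithinAt.subtypeVal_comp_iff]
  have hval : ContMDiffAt 𝓘(ℝ, ℂ × ℂ) 𝓘(ℝ, ℂ × ℂ) ∞ (Subtype.val : G.box → ℂ × ℂ) q :=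
    contMDiff_subtype_val (I := 𝓘(ℝ, ℂ × ℂ)) (n := ∞) (U := G.box) q
  have h : ContMDiffAt 𝓘(ℝ, ℂ × ℂ) (𝓡 4) ∞ (endPt p ∘ (Subtype.val : G.box → ℂ × ℂ)) q :=
    (G.contMDiffAt_endPt (G.mem_tgt_iff.1 hq) (G.norm_fst_lt q)).comp q hval
  refine h.contMDiffWithinAt.congr (fun q' hq' => ?_) ?_
  · exact G.coe_glueInv_of_mem hq'
  · exact G.coe_glueInv_of_mem hq

/-- **The gluing partial homeomorphism** `ψ : {x ∈ V | 1/ρ < ‖z‖, ‖w − b₀‖ < ρ'} ≅ {x' ≠ 0} ⊂ Ω`,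
`ψ x = (1/z(x), w(x))`. [cite: Wendl2018, proof of Prop. 2.53 (p. 65)] -/
def glueHomeo [IsManifold (𝓡 4) ∞ M] : OpenPartialHomeomorph (punctured p) G.box where
  toFun := G.glueFun
  invFun := G.glueInv
  source := G.src
  target := G.tgt
  map_source' := fun _ hx => G.glueFun_mem_tgt hx
  map_target' := fun _ hq => G.glueInv_mem_src hq
  left_inv' := fun _ hx => G.glueInv_glueFun hx
  right_inv' := fun _ hq => G.glueFun_glueInv hq
  open_source := G.isOpen_src
  open_target := G.isOpen_tgt
  continuousOn_toFun := G.contMDiffOn_glueFun.continuousOn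
  continuousOn_invFun := G.contMDiffOn_glueInv.continuousOn

variable [IsManifold (𝓡 4) ∞ M]

/-- The gluing homeomorphism is `glueFun`. [folklore] -/
@[simp] theorem glueHomeo_apply (x : punctured p) : G.glueHomeo x = G.glueFun x := rfl

/-- The inverse gluing homeomorphism is `glueInv`. [folklore] -/
@[simp] theorem glueHomeo_symm_apply (q : G.box) : G.glueHomeo.symm q = G.glueInv q := rfl

/-- The source of the gluing homeomorphism. [folklore] -/
@[simp] theorem glueHomeo_source : G.glueHomeo.source = G.src := rfl

/-- The target of the gluing homeomorphism. [folklore] -/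
@[simp] theorem glueHomeo_target : G.glueHomeo.target = G.tgt := rfl

/-- **The gluing datum** of the blown-up partial end-compactification.
[cite: Wendl2018, proof of Prop. 2.53 (p. 65)] -/
def glueData : SmoothGlueData (𝓡 4) 𝓘(ℝ, ℂ × ℂ) (punctured p) G.box (EuclideanSpace ℝ (Fin 4)) where
  glue := G.glueHomeo
  contMDiffOn_glue := G.contMDiffOn_glueFun
  contMDiffOn_glue_symm := G.contMDiffOn_glueInv
  linA := ContinuousLinearEquiv.refl ℝ _
  linB := flatCx.symm

/-- The gluing map of the datum. [folklore] -/
@[simp] theorem glueData_glue : G.glueData.glue = G.glueHomeo := rfl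

/-- The model identification of the first piece is the identity. [folklore] -/
@[simp] theorem glueData_linA : G.glueData.linA = ContinuousLinearEquiv.refl ℝ _ := rfl

/-- The model identification of the box is `flatCx⁻¹`. [folklore] -/
@[simp] theorem glueData_linB : G.glueData.linB = flatCx.symm := rfl

/-- **The blown-up partial end-compactification** `Y = (M ∖ p) ∪_ψ Ω`, a `C^∞` `4`-manifold
modelled on `ℝ⁴` (instances `SmoothGlueData.instChartedSpace`, `instIsManifold`).
[cite: Wendl2018, proof of Prop. 2.53 (p. 65)] -/
abbrev Y : Type _ := G.glueData.Glued

/-- The inclusion of the punctured manifold. [folklore] -/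
abbrev inP : punctured p → G.Y := G.glueData.inl

/-- The inclusion of the box. [folklore] -/
abbrev inB : G.box → G.Y := G.glueData.inr

/-- `inP x = inB q ↔ x ∈ src ∧ glueFun x = q`. [folklore] -/
theorem inP_eq_inB_iff {x : punctured p} {q : G.box} :
    G.inP x = G.inB q ↔ x ∈ G.src ∧ G.glueFun x = q :=
  G.glueData.inl_eq_inr_iff

/-- The exceptional disc `E = inB {x' = 0}` misses the punctured manifold. [folklore] -/
theorem inB_notMem_range_inP {q : G.box} (hq : (q : ℂ × ℂ).1 = 0) : G.inB q ∉ range G.inP := by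
  rw [SmoothGlueData.inr_mem_range_inl_iff, glueData_glue, glueHomeo_target, mem_tgt_iff]
  exact fun h => h hq

/-! ### Hausdorffness and second countability -/

omit [IsManifold (𝓡 4) ∞ M] in
/-- **The graph of the gluing map is closed** in `(M ∖ p) × Ω`: a limit of graph points
`(endPt qₙ, qₙ)` with `qₙ → q`, `x'(q) ≠ 0`, is `(endPt q, q)` by continuity, and `x'(q) = 0` is
impossible since then `endPt qₙ → p`. [cite: Kosinski1993, VI.1] -/
theorem isClosed_graph [SecondCountableTopology M] :
    IsClosed {w : punctured p × G.box | w.1 ∈ G.src ∧ G.glueFun w.1 = w.2} := by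
  refine IsSeqClosed.isClosed fun u w hu huw => ?_
  have hu' : ∀ n, (u n).2 ∈ G.tgt ∧ G.glueInv (u n).2 = (u n).1 := fun n => by
    obtain ⟨h1, h2⟩ := hu n
    refine ⟨h2 ▸ G.glueFun_mem_tgt h1, ?_⟩
    rw [← h2]
    exact G.glueInv_glueFun h1
  have h1 : Tendsto (fun n => (u n).1) atTop (𝓝 w.1) := (continuous_fst.tendsto _).comp huw
  have h2 : Tendsto (fun n => (u n).2) atTop (𝓝 w.2) := (continuous_snd.tendsto _).comp huw
  have h2' : Tendsto (fun n => ((u n).2 : ℂ × ℂ)) atTop (𝓝 (w.2 : ℂ × ℂ)) :=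
    (continuous_subtype_val.tendsto _).comp h2
  have hM : Tendsto (fun n => ((u n).1 : M)) atTop (𝓝 (w.1 : M)) :=
    (continuous_subtype_val.tendsto _).comp h1
  have hptn : ∀ n, ((u n).1 : M) = endPt p (u n).2 := fun n => by
    rw [← (hu' n).2]; exact G.coe_glueInv_of_mem (hu' n).1
  by_cases hq : ((w.2 : G.box) : ℂ × ℂ).1 = 0
  · -- the limit would be `p`
    exfalso
    have hv0 : Tendsto (fun n => endChartVec ((u n).2 : ℂ × ℂ)) atTop (𝓝 0) := by
      rw [tendsto_zero_iff_norm_tendsto_zero]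
      have h0 : Tendsto (fun n => ‖((u n).2 : ℂ × ℂ).1‖) atTop (𝓝 0) := by
        have := ((continuous_fst.tendsto _).comp h2').norm
        rwa [hq, norm_zero] at this
      exact squeeze_zero (fun n => norm_nonneg _) (fun n => norm_endChartVec_le (hu' n).1) h0
    have hv : Tendsto (fun n => extChartAt (𝓡 4) p p + endChartVec ((u n).2 : ℂ × ℂ)) atTop
        (𝓝 (extChartAt (𝓡 4) p p)) := by
      have := (tendsto_const_nhds (x := extChartAt (𝓡 4) p p) (f := (atTop : Filter ℕ))).add hv0
      rwa [add_zero] at this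
    have hlim : Tendsto (fun n => ((u n).1 : M)) atTop (𝓝 p) := by
      have hc : ContinuousAt (extChartAt (𝓡 4) p).symm (extChartAt (𝓡 4) p p) :=
        (continuousOn_extChartAt_symm (I := 𝓡 4) p).continuousAt
          ((isOpen_extChartAt_target p).mem_nhds (mem_extChartAt_target (I := 𝓡 4) p))
      have h3 : Tendsto (fun n => (extChartAt (𝓡 4) p).symm
          (extChartAt (𝓡 4) p p + endChartVec ((u n).2 : ℂ × ℂ))) atTop
          (𝓝 ((extChartAt (𝓡 4) p).symm (extChartAt (𝓡 4) p p))) := hc.tendsto.comp hv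
      rw [extChartAt_to_inv] at h3
      refine h3.congr fun n => ?_
      rw [hptn n, endPt_def]
    exact (mem_punctured.1 w.1.2) (tendsto_nhds_unique hM hlim)
  · -- continuity of `endPt` at `q`
    have hcont := G.continuousAt_endPt hq (G.norm_fst_lt w.2)
    have hlim : Tendsto (fun n => ((u n).1 : M)) atTop (𝓝 (endPt p w.2)) :=
      (hcont.tendsto.comp h2').congr fun n => (hptn n).symm
    have heq : (w.1 : M) = endPt p w.2 := tendsto_nhds_unique hM hlim
    have hw2 : w.2 ∈ G.tgt := hq
    have hw1 : w.1 = G.glueInv w.2 := Subtype.ext (by rw [heq, G.coe_glueInv_of_mem hw2])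
    refine ⟨?_, ?_⟩
    · rw [hw1]; exact G.glueInv_mem_src hw2
    · rw [hw1]; exact G.glueFun_glueInv hw2

/-- **The glued end-compactification is Hausdorff.** [cite: Kosinski1993, VI.1] -/
instance instT2SpaceY [SecondCountableTopology M] : T2Space G.Y :=
  G.glueData.t2Space_of_isClosed_graph G.isClosed_graph

/-- The glued space is σ-compact (images of the σ-compact pieces). [folklore] -/
instance instSigmaCompactSpaceY [SecondCountableTopology M] : SigmaCompactSpace G.Y := by
  haveI : LocallyCompactSpace (punctured p) :=
    ChartedSpace.locallyCompactSpace (EuclideanSpace ℝ (Fin 4)) (punctured p)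
  haveI : LocallyCompactSpace G.box := ChartedSpace.locallyCompactSpace (ℂ × ℂ) G.box
  haveI : SigmaCompactSpace (punctured p) := sigmaCompactSpace_of_locallyCompact_secondCountable
  haveI : SigmaCompactSpace G.box := sigmaCompactSpace_of_locallyCompact_secondCountable
  refine ⟨?_⟩
  rw [← G.glueData.range_inl_union_range_inr, ← image_univ, ← image_univ, union_eq_iUnion]
  refine isSigmaCompact_iUnion _ fun b => ?_
  cases b
  · exact isSigmaCompact_univ.image G.glueData.continuous_inr
  · exact isSigmaCompact_univ.image G.glueData.continuous_inl

/-- **The glued end-compactification is second countable.** [folklore] -/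
instance instSecondCountableTopologyY [SecondCountableTopology M] : SecondCountableTopology G.Y :=
  G.glueData.secondCountableTopology

end PencilEnd

end Literature.Geometry.Symplectic
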